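import Summits.QuantumFields.YangMills.Theorems.BalabanUVNodesN16HolderMSDefs
import Summits.QuantumFields.YangMills.Theorems.BalabanUVNodesN16AtRRec13Lines
import Summits.QuantumFields.YangMills.Theorems.BalabanUVNodesRateReadingOfRecord13

/-!
# Route «BalabanUVNodes», cluster K4 «SpineRates» — node N16 = NE3: THE HOME SIDE OF REPAIR R-β″ AT NODE 00's STAGE-13 RECORD — dag-n16-c's candidate stub
# `S_N16HolderMS β` (the covariant root with the MULTI-SCALE (3.40) Hölder member) at the rate homes `RRec₁₃On 𝔯 Rg` ∕ `RRec₁₃ 𝔯`, at RR-1's NE3 object of record, and at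
# dag-n22-e's NAMED reading of record `readingOfRecord₁₃ w1 ℓ₃ ne2 ne1`; N21's MS-face; the weakening ladder MS ⇒ β ⇒ (β = 1) the stub of record, AT THE HOMES

Cell `pub-ymgap`, seat `pub-ymgap-dag-n16-e` (R134 acceleration seat (a), strategy s2 = BY-NAME KNIT at the record; HUMAN RULING D-0062; chair R424 venue),
generation 6, module 22 (THEOREMS ONLY, 0 `def`, 0 `sorry`).  `bears_on: R4∕N16 · out-edge N16 → N21 · K3‴ SpineGivenEndpointR13 (stmt-QuantumFields-19912,
`--supports … --as helper`, dag-lead KEY TABLE WORDS-133 ∕ FAN-OUT v1.3)`.  pub-ymgap INBOX DAGN16E-G6-STARTED ∕ INTENT-22.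

WHY.  dag-n16-c g4 opened a THIRD repair option for the located item «the Hölder-exponent pin of N16's N05-socket» (`HOME/pub-ymgap-dag-n16-c/LOCATED-N16-HOLDER-PIN.md`):
R-β″ = the WINDOW-FREE Hölder road — the β-root's third covariant conjunct read ALONG LATTICE LINES at every separation `1 ≤ j ≤ L^k` (the multi-scale member of
[Balaban1985BackgroundPropagators] (3.40), i.e. of [Balaban1985RegularSpaces] (1.36)), under which NE7's consumers survive for EVERY `β > 0` (`…N16HolderMultiScale(Rates)`,
p491275 ∕ p491997) — and landed its DEFINITIONS `…N16HolderMSDefs` (p492484: `CovRootHolderMS`, `N16HolderMSAt c β`, the candidate stub `S_N16HolderMS β RRec`, N21's MS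
consumer END `closeness_of_covRootHolderMS`, the projections `covRootHolder_of_covRootHolderMS` ∕ `s_N16Holder_of_s_N16HolderMS` ∕ `s_N16_of_s_N16HolderMS_one`) together with
the MS producer column.  For R-β this seat landed the HOME side (F1) `…N16HolderAtRecord12` (p482004) and its Stage-13 successor module 20 `…N16AtRRec13Lines` §1–§3 (p494677)
over dag-n16-c's β-kit; this module is the same HOME side in the MS currency, so that on an R-β″ ruling the K3‴ composer's `h16 : S_N16HolderMS β (RRec₁₃On 𝔯 (unityNondeg₁₃ 2))`
and N21's MS consumer END meet BY NAME at the Stage-13 record exactly as R-β's two sides do today — nothing of the MS kit is orphaned and nothing of record is edited.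

CONTENT (every theorem a ONE-APPLICATION composition BY NAME; the (T-RATE) generic master face `rateStub_rRec₁₃On_iff`, RR-1's constant layer `ne3ConstLayerOfRecord₁₁`,
dag-n22-e's `readingOfRecord₁₃_ne3` (`rfl`), dag-n16-c's projections).
§1 MASTER FACES — `s_N16HolderMS_rRec₁₃On_iff` (guarded θ-form), `s_N16HolderMS_rRec₁₃_iff`; `s_N16HolderMS_rRec₁₃On_anti`, `s_N16HolderMS_rRec₁₃_of_rRec₁₃On_true`; THE
  WEAKENING LADDER AT THE HOMES, side-condition-free (the block factor `1 ≤ R.ne3.L` dag-n16-c's projections ask is the family's `2 ≤ F.L` on every pinned bundle):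
  `s_N16Holder_rRec₁₃On_of_s_N16HolderMS`, `s_N16Holder_rRec₁₃_of_s_N16HolderMS`, `s_N16_rRec₁₃On_of_s_N16HolderMS_one`, `s_N16_rRec₁₃_of_s_N16HolderMS_one`.
§2 CONSTANT NE3 LAYERS — `s_N16HolderMS_rRec₁₃On_iff_of_constLayer`, `s_N16HolderMS_rRec₁₃_iff_of_constLayer`, `s_N16HolderMS_rRec₁₃On_of_s_N16HolderMS_rRec₁₃_constLayer`
  (the two homes agree: canonical ⇒ regime-restricted, every regime).
§3 AT RR-1's NE3 OBJECT OF RECORD (`hpin`-generic) — `s_N16HolderMS_rRec₁₃On_iff_ofRecord`, `n16HolderMSAt_of_s_N16HolderMS_rRec₁₃On_ofRecord`, ★ N21's MS-FACE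
  `covRootHolderMS_rRec₁₃On_ofRecord` (`CovRootHolderMS 4 (sfClass …) … β (ne3DomOfRecord₁₁ F N 0 0)` at every guarded family — the `h` of `closeness_of_covRootHolderMS`),
  `s_N16HolderMS_rRec₁₃_iff_ofRecord`, `covRootHolderMS_rRec₁₃_ofRecord`, `s_N16HolderMS_rRec₁₃On_ofRecord_of_rRec₁₃`.
§4 AT THE NAMED STAGE-13 READING OF RECORD `readingOfRecord₁₃ w1 ℓ₃ ne2 ne1` (dag-n22-e 6″, p495075; `hpin := readingOfRecord₁₃_ne3`) — `s_N16HolderMS_readingOfRecord₁₃On_iff`,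
  `s_N16HolderMS_readingOfRecord₁₃_iff`, `covRootHolderMS_readingOfRecord₁₃On`, `covRootHolderMS_readingOfRecord₁₃`.
§5 HONESTY (R422) — `s_N16HolderMS_rRec₁₃On_of_guard_empty` (vacuous on an empty guard), `not_s_N16HolderMS_rRec₁₃On_of_not_s_N16Holder` (the MS stub is refuted wherever the
  β-stub is: every junk test of modules 19 ∕ 20 transfers).

NOT HERE (dag-n16-c's custody unless declined; pub-ymgap INBOX DAGN16E-G6-STARTED): the record-level MS regime ∕ slot kit (`PrintSlotHolderMS`, `radiusOfRecordHMS`,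
`constOfRecordHMS`, `InEndRegimeHMS`, `LeafSlotHolderMS`) and the MS N16 LINE — their entry `leafSlotHolderMS_of_b8LeafRS` waits on the MS producer tops (R1)–(R7).

HONEST FRAMING.  Kernel bookkeeping by name; no estimate; `S_N16HolderMS β` is dag-n16-c's CANDIDATE stub wording for the located repair R-β″ — the statement edit is the planner's ∕
director's (R-β ∕ R-β″ ∕ R-Δ ∕ status quo UNRULED), nothing of record is edited; the reading `𝔯` is a PARAMETER pinned only through `hpin` (§4: dag-n22-e's named reading, whose
`w1` ∕ `ne2` ∕ `ne1` are residual DATA); no admissible Stage-13 tuple with provisos is claimed to exist (K0‴ `Record13Inhabited`, stmt-QuantumFields-19909, OPEN); nothing of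
Bałaban's is asserted; **N16 ∕ NE3 is NOT discharged**; count-neutral (typed 28∕28 · discharged 5∕27, A 5∕28 UNMOVED); one finite four-torus at fixed ε — NOT ℝ⁴, NOT infinite
volume, NOT OS, NOT a mass gap, NOT Clay.  No decl below carries a cite tag (all `[folklore]` bookkeeping).
-/

set_option autoImplicit false

open scoped BigOperators Matrix Matrix.Norms.L2Operator
open NormedSpace

namespace Summit.QuantumFields.YangMills.BalabanUVNodes.N16HolderMSAtRecord13

open Literature.MathematicalPhysics.QuantumFieldTheory.Balaban1983to89
open Literature.MathematicalPhysics.QuantumFieldTheory.Balaban1983to89.T4Continuum (T4Family ULoop)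
open B7Prop1Explicit B7Prop2Explicit
open Node00 (IsDatumOfRecord₁₃C Stage13Params NE3Objects₁₁ NE3Letters₁₁ NE2Objects₁₁ ne3LOfRecord₁₁ ne3ConstLayerOfRecord₁₁ ne3NperOfRecord₁₁ ne3DomOfRecord₁₁ MatA)
open Node00.W1 (ReadingData)
open Summit.QuantumFields.BalabanUV.T4Continuum
open MinimalActionRate (sfClass)
open YMDAG.UVSplit (Datum NE3Carriers NE1pCarriers RateCarriers S_N16 ne3OfRecord₁₁ RateReading₁₃ RRec₁₃ RRec₁₃On rateStub_rRec₁₃On_iff rRec₁₃On_mono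
  rRec₁₃_le_rRec₁₃On_true rRec₁₃On_self readingOfRecord₁₃ readingOfRecord₁₃_ne3)
open Summit.QuantumFields.YangMills.BalabanUVNodes.N16HolderDefs (S_N16Holder)
open Summit.QuantumFields.YangMills.BalabanUVNodes.N16HolderMSDefs (CovRootHolderMS N16HolderMSAt S_N16HolderMS s_N16Holder_of_s_N16HolderMS s_N16_of_s_N16HolderMS_one)
open Summit.QuantumFields.YangMills.BalabanUVNodes.N16AtRRec13Lines (s_N16Holder_rRec₁₃On_iff_of_constLayer)

noncomputable section

variable {N : ℕ} [NeZero N] (β : ℝ) (𝔯 : RateReading₁₃ N) (Rg : (F : T4Family) → Stage13Params F N → Prop)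

/-! ## §1 Master faces, regime monotonicity, the weakening ladder at the homes -/

/-- **`S_N16HolderMS β` AT THE REGIME-RESTRICTED HOME — GUARDED θ-FORM**: `S_N16HolderMS β (RRec₁₃On 𝔯 Rg)` iff for every family, every admissible Stage-13 tuple `θ` with
provisos `hP` in `Rg`, every `(g₀, os)` and run length `k`, `N16HolderMSAt (ne3OfRecord₁₁ F ((𝔯.lit F θ hP g₀ os).ne3 k)) β` (dag-n22-e's `rateStub_rRec₁₃On_iff`). [folklore] -/
theorem s_N16HolderMS_rRec₁₃On_iff :
    S_N16HolderMS β (RRec₁₃On 𝔯 Rg) ↔ ∀ (F : T4Family) (θ : Stage13Params F N) (hP : θ.Provisos₁₃ F N), Rg F θ → θ.Admissible F N →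
      ∀ (g₀ : ℕ → ℝ) (os : List (ULoop F)) (k : ℕ), N16HolderMSAt (ne3OfRecord₁₁ F ((𝔯.lit F θ hP g₀ os).ne3 k)) β :=
  rateStub_rRec₁₃On_iff 𝔯 Rg fun _ R => N16HolderMSAt R.ne3 β

/-- **`S_N16HolderMS β` AT THE CANONICAL HOME**: iff for every family, datum with its Stage-13 key `h`, `(g₀, os)` and run length `k`,
`N16HolderMSAt (ne3OfRecord₁₁ F ((𝔯.lit F h.params h.provisos g₀ os).ne3 k)) β`. [folklore] -/
theorem s_N16HolderMS_rRec₁₃_iff :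
    S_N16HolderMS β (RRec₁₃ 𝔯) ↔ ∀ (F : T4Family) (D : Datum F N) (h : IsDatumOfRecord₁₃C F N D) (g₀ : ℕ → ℝ) (os : List (ULoop F)) (k : ℕ),
      N16HolderMSAt (ne3OfRecord₁₁ F ((𝔯.lit F h.params h.provisos g₀ os).ne3 k)) β := by
  constructor
  · intro hS F D h g₀ os k
    exact hS F D g₀ os _ ⟨h, k, rfl⟩
  · rintro hS F D g₀ os R ⟨h, k, rfl⟩
    exact hS F D h g₀ os k

/-- **ANTITONE IN THE REGIME**: a larger regime asks more. [folklore] -/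
theorem s_N16HolderMS_rRec₁₃On_anti {Rg Rg' : (F : T4Family) → Stage13Params F N → Prop} (h : ∀ F θ, Rg F θ → Rg' F θ)
    (hS : S_N16HolderMS β (RRec₁₃On 𝔯 Rg')) : S_N16HolderMS β (RRec₁₃On 𝔯 Rg) :=
  fun F D g₀ os R hR => hS F D g₀ os R (rRec₁₃On_mono 𝔯 h hR)

/-- **THE TRIVIAL REGIME COVERS THE CANONICAL HOME**. [folklore] -/
theorem s_N16HolderMS_rRec₁₃_of_rRec₁₃On_true (hS : S_N16HolderMS β (RRec₁₃On 𝔯 fun _ _ => True)) : S_N16HolderMS β (RRec₁₃ 𝔯) :=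
  fun F D g₀ os R hR => hS F D g₀ os R (rRec₁₃_le_rRec₁₃On_true 𝔯 hR)

/-- **THE WEAKENING MS ⇒ β AT THE REGIME-RESTRICTED HOME, NO SIDE CONDITION**: `S_N16HolderMS β (RRec₁₃On 𝔯 Rg) → S_N16Holder β (RRec₁₃On 𝔯 Rg)` — dag-n16-c's
`s_N16Holder_of_s_N16HolderMS` asks the block factor `1 ≤ R.ne3.L` of every pinned bundle; at this home every pinned bundle is `ne3OfRecord₁₁ F _`, whose block factor is the
family's `F.L ≥ 2`. [folklore] -/
theorem s_N16Holder_rRec₁₃On_of_s_N16HolderMS (hS : S_N16HolderMS β (RRec₁₃On 𝔯 Rg)) : S_N16Holder β (RRec₁₃On 𝔯 Rg) :=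
  s_N16Holder_of_s_N16HolderMS hS fun F D g₀ os R hR => by
    obtain ⟨θ, hP, -, -, -, k, rfl⟩ := hR
    exact le_trans one_le_two (HistoryFlow.two_le_L F)

/-- **THE WEAKENING MS ⇒ β AT THE CANONICAL HOME, NO SIDE CONDITION**. [folklore] -/
theorem s_N16Holder_rRec₁₃_of_s_N16HolderMS (hS : S_N16HolderMS β (RRec₁₃ 𝔯)) : S_N16Holder β (RRec₁₃ 𝔯) :=
  s_N16Holder_of_s_N16HolderMS hS fun F D g₀ os R hR => by
    obtain ⟨h, k, rfl⟩ := hR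
    exact le_trans one_le_two (HistoryFlow.two_le_L F)

/-- **AT `β = 1` THE MS STUB IMPLIES THE STUB OF RECORD AT THE REGIME-RESTRICTED HOME, NO SIDE CONDITION**: `S_N16HolderMS 1 (RRec₁₃On 𝔯 Rg) → S_N16 (RRec₁₃On 𝔯 Rg)`
(dag-n16-c's `s_N16_of_s_N16HolderMS_one`; the K3‴ composer's `h16` of record from the MS wording at exponent one). [folklore] -/
theorem s_N16_rRec₁₃On_of_s_N16HolderMS_one (hS : S_N16HolderMS 1 (RRec₁₃On 𝔯 Rg)) : S_N16 (RRec₁₃On 𝔯 Rg) :=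
  s_N16_of_s_N16HolderMS_one hS fun F D g₀ os R hR => by
    obtain ⟨θ, hP, -, -, -, k, rfl⟩ := hR
    exact le_trans one_le_two (HistoryFlow.two_le_L F)

/-- **AT `β = 1` THE MS STUB IMPLIES THE STUB OF RECORD AT THE CANONICAL HOME, NO SIDE CONDITION**. [folklore] -/
theorem s_N16_rRec₁₃_of_s_N16HolderMS_one (hS : S_N16HolderMS 1 (RRec₁₃ 𝔯)) : S_N16 (RRec₁₃ 𝔯) :=
  s_N16_of_s_N16HolderMS_one hS fun F D g₀ os R hR => by
    obtain ⟨h, k, rfl⟩ := hR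
    exact le_trans one_le_two (HistoryFlow.two_le_L F)

/-! ## §2 Readings with a constant NE3 layer; the two Stage-13 homes agree -/

section ConstLayer

variable (o : T4Family → NE3Objects₁₁ N)
  (hpin : ∀ (F : T4Family) (θ : Stage13Params F N) (hP : θ.Provisos₁₃ F N) (g₀ : ℕ → ℝ) (os : List (ULoop F)) (k : ℕ), (𝔯.lit F θ hP g₀ os).ne3 k = o F)
include hpin

/-- **FOR A READING WHOSE NE3 COMPONENT IS CONSTANTLY `o F`, `S_N16HolderMS β (RRec₁₃On 𝔯 Rg)` IS ONE `N16HolderMSAt … β` PER GUARDED FAMILY.** [folklore] -/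
theorem s_N16HolderMS_rRec₁₃On_iff_of_constLayer :
    S_N16HolderMS β (RRec₁₃On 𝔯 Rg) ↔ ∀ (F : T4Family), (∃ θ : Stage13Params F N, θ.Provisos₁₃ F N ∧ Rg F θ ∧ θ.Admissible F N) →
      N16HolderMSAt (ne3OfRecord₁₁ F (o F)) β := by
  rw [s_N16HolderMS_rRec₁₃On_iff]
  constructor
  · rintro h F ⟨θ, hP, hRg, hθ⟩
    have h' := h F θ hP hRg hθ (fun _ => 0) [] 0
    rwa [hpin] at h'
  · intro h F θ hP hRg hθ g₀ os k
    rw [hpin]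
    exact h F ⟨θ, hP, hRg, hθ⟩

/-- **THE SAME AT THE CANONICAL HOME**: one `N16HolderMSAt … β` per family carrying a Stage-13 datum of record. [folklore] -/
theorem s_N16HolderMS_rRec₁₃_iff_of_constLayer :
    S_N16HolderMS β (RRec₁₃ 𝔯) ↔ ∀ (F : T4Family), (∃ D : Datum F N, IsDatumOfRecord₁₃C F N D) → N16HolderMSAt (ne3OfRecord₁₁ F (o F)) β := by
  rw [s_N16HolderMS_rRec₁₃_iff]
  constructor
  · rintro h F ⟨D, hD⟩
    have h' := h F D hD (fun _ => 0) [] 0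
    rwa [hpin] at h'
  · intro h F D hD g₀ os k
    rw [hpin]
    exact h F ⟨D, hD⟩

/-- **THE TWO STAGE-13 HOMES AGREE AT A CONSTANT LAYER — CANONICAL ⇒ REGIME-RESTRICTED, EVERY REGIME**: a guarded admissible tuple with provisos realises a Stage-13 datum of
record (the (T-RATE) face `RRec₁₃On.isDatumOfRecord₁₃C` at `rRec₁₃On_self`), at which the canonical home's sentence reads `N16HolderMSAt (ne3OfRecord₁₁ F (o F)) β`; the object
being tuple-free, that is all the regime-restricted home asks. [folklore] -/
theorem s_N16HolderMS_rRec₁₃On_of_s_N16HolderMS_rRec₁₃_constLayer (hS : S_N16HolderMS β (RRec₁₃ 𝔯)) : S_N16HolderMS β (RRec₁₃On 𝔯 Rg) :=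
  (s_N16HolderMS_rRec₁₃On_iff_of_constLayer β 𝔯 Rg o hpin).2 fun F ⟨θ, hP, hRg, hθ⟩ =>
    (s_N16HolderMS_rRec₁₃_iff_of_constLayer β 𝔯 o hpin).1 hS F ⟨_, (rRec₁₃On_self 𝔯 Rg θ hP hRg hθ (fun _ => 0) [] 0).isDatumOfRecord₁₃C⟩

end ConstLayer

/-! ## §3 `S_N16HolderMS β` at RR-1's NE3 object of record (`hpin`-generic: at the named Stage-13 reading of record `hpin := readingOfRecord₁₃_ne3 …`, §4) -/

section OfRecord

variable (ℓ : T4Family → NE3Letters₁₁)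
  (hpin : ∀ (F : T4Family) (θ : Stage13Params F N) (hP : θ.Provisos₁₃ F N) (g₀ : ℕ → ℝ) (os : List (ULoop F)) (k : ℕ),
    (𝔯.lit F θ hP g₀ os).ne3 k = ne3ConstLayerOfRecord₁₁ F N (ℓ F))
include hpin

/-- **`S_N16HolderMS β` AT THE OBJECT OF RECORD, REGIME-RESTRICTED HOME** IS «`N16HolderMSAt (ne3OfRecord₁₁ F (ne3ConstLayerOfRecord₁₁ F N (ℓ F))) β` for every family
carrying an admissible Stage-13 tuple with provisos in `Rg`». [folklore] -/
theorem s_N16HolderMS_rRec₁₃On_iff_ofRecord :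
    S_N16HolderMS β (RRec₁₃On 𝔯 Rg) ↔ ∀ (F : T4Family), (∃ θ : Stage13Params F N, θ.Provisos₁₃ F N ∧ Rg F θ ∧ θ.Admissible F N) →
      N16HolderMSAt (ne3OfRecord₁₁ F (ne3ConstLayerOfRecord₁₁ F N (ℓ F))) β :=
  s_N16HolderMS_rRec₁₃On_iff_of_constLayer β 𝔯 Rg (fun F => ne3ConstLayerOfRecord₁₁ F N (ℓ F)) hpin

/-- **THE `h16` READ-OUT AT THE OBJECT OF RECORD, REGIME-RESTRICTED, MS CURRENCY**. [folklore] -/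
theorem n16HolderMSAt_of_s_N16HolderMS_rRec₁₃On_ofRecord (hS : S_N16HolderMS β (RRec₁₃On 𝔯 Rg)) (F : T4Family) {θ : Stage13Params F N}
    (hP : θ.Provisos₁₃ F N) (hRg : Rg F θ) (hθ : θ.Admissible F N) : N16HolderMSAt (ne3OfRecord₁₁ F (ne3ConstLayerOfRecord₁₁ F N (ℓ F))) β :=
  (s_N16HolderMS_rRec₁₃On_iff_ofRecord β 𝔯 Rg ℓ hpin).1 hS F ⟨θ, hP, hRg, hθ⟩

/-- ★ **N21's MS-FACE AT THE OBJECT OF RECORD, REGIME-RESTRICTED**: under the candidate stub, at every guarded family the MS β-root `CovRootHolderMS` at RR-1's period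
`ne3NperOfRecord₁₁ F 0 0 = 2·L^m`, the letters `ℓ F` and the data of record `ne3DomOfRecord₁₁ F N 0 0` (`N16HolderMSAt` unfolded) — literally the hypothesis `h` of dag-n16-c's
NE7 consumer END `N16HolderMSDefs.closeness_of_covRootHolderMS` ((P) at `θ^{8k}`, (Gᶜ)∕(C)∕(Q) at `(θ^k)^{(12+14β)∕(1+β)}`, below the plaquette margin for every `β > 0`).
[folklore] -/
theorem covRootHolderMS_rRec₁₃On_ofRecord (hS : S_N16HolderMS β (RRec₁₃On 𝔯 Rg)) (F : T4Family) {θ : Stage13Params F N} (hP : θ.Provisos₁₃ F N) (hRg : Rg F θ)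
    (hθ : θ.Admissible F N) :
    CovRootHolderMS 4 (sfClass 4 (ne3LOfRecord₁₁ F) (ne3NperOfRecord₁₁ F 0 0) (ℓ F).ε) (ne3LOfRecord₁₁ F) (ne3NperOfRecord₁₁ F 0 0) (ℓ F).b (ℓ F).g (ℓ F).C
      (ℓ F).Λ₁ (ℓ F).Λ₂' β (ne3DomOfRecord₁₁ F N 0 0) :=
  n16HolderMSAt_of_s_N16HolderMS_rRec₁₃On_ofRecord β 𝔯 Rg ℓ hpin hS F hP hRg hθ

/-- **`S_N16HolderMS β` AT THE OBJECT OF RECORD, CANONICAL HOME** IS «`N16HolderMSAt (ne3OfRecord₁₁ F (ne3ConstLayerOfRecord₁₁ F N (ℓ F))) β` for every family carrying a Stage-13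
datum of record». [folklore] -/
theorem s_N16HolderMS_rRec₁₃_iff_ofRecord :
    S_N16HolderMS β (RRec₁₃ 𝔯) ↔ ∀ (F : T4Family), (∃ D : Datum F N, IsDatumOfRecord₁₃C F N D) →
      N16HolderMSAt (ne3OfRecord₁₁ F (ne3ConstLayerOfRecord₁₁ F N (ℓ F))) β :=
  s_N16HolderMS_rRec₁₃_iff_of_constLayer β 𝔯 (fun F => ne3ConstLayerOfRecord₁₁ F N (ℓ F)) hpin

/-- **N21's MS-FACE AT THE OBJECT OF RECORD, CANONICAL HOME** (one family carrying a Stage-13 datum of record). [folklore] -/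
theorem covRootHolderMS_rRec₁₃_ofRecord (hS : S_N16HolderMS β (RRec₁₃ 𝔯)) (F : T4Family) {D : Datum F N} (hD : IsDatumOfRecord₁₃C F N D) :
    CovRootHolderMS 4 (sfClass 4 (ne3LOfRecord₁₁ F) (ne3NperOfRecord₁₁ F 0 0) (ℓ F).ε) (ne3LOfRecord₁₁ F) (ne3NperOfRecord₁₁ F 0 0) (ℓ F).b (ℓ F).g (ℓ F).C
      (ℓ F).Λ₁ (ℓ F).Λ₂' β (ne3DomOfRecord₁₁ F N 0 0) :=
  (s_N16HolderMS_rRec₁₃_iff_ofRecord β 𝔯 ℓ hpin).1 hS F ⟨D, hD⟩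

/-- **THE TWO HOMES AGREE AT THE OBJECT OF RECORD — CANONICAL ⇒ REGIME-RESTRICTED, EVERY REGIME**. [folklore] -/
theorem s_N16HolderMS_rRec₁₃On_ofRecord_of_rRec₁₃ (hS : S_N16HolderMS β (RRec₁₃ 𝔯)) : S_N16HolderMS β (RRec₁₃On 𝔯 Rg) :=
  s_N16HolderMS_rRec₁₃On_of_s_N16HolderMS_rRec₁₃_constLayer β 𝔯 Rg (fun F => ne3ConstLayerOfRecord₁₁ F N (ℓ F)) hpin hS

end OfRecord

/-! ## §4 At dag-n22-e's NAMED Stage-13 reading of record `readingOfRecord₁₃ w1 ℓ₃ ne2 ne1` (every `hpin` is `readingOfRecord₁₃_ne3`, `rfl`) -/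

section NamedReading

variable (w1 : (F : T4Family) → (θ : Stage13Params F N) → ReadingData F (MatA N) θ.τ9.M) (ℓ₃ : T4Family → NE3Letters₁₁)
  (ne2 : (F : T4Family) → Stage13Params F N → (ℕ → ℝ) → List (ULoop F) → ℕ → NE2Objects₁₁)
  (ne1 : (F : T4Family) → Stage13Params F N → (ℕ → ℝ) → List (ULoop F) → NE1pCarriers)

/-- **`S_N16HolderMS β` AT THE REGIME-RESTRICTED READING OF RECORD** IS «`N16HolderMSAt` at RR-1's object with letters `ℓ₃ F` for every family carrying an admissible Stage-13
tuple with provisos in `Rg`» (the reading's `w1` ∕ `ne2` ∕ `ne1` are not read by N16). [folklore] -/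
theorem s_N16HolderMS_readingOfRecord₁₃On_iff :
    S_N16HolderMS β (RRec₁₃On (readingOfRecord₁₃ w1 ℓ₃ ne2 ne1) Rg) ↔
      ∀ (F : T4Family), (∃ θ : Stage13Params F N, θ.Provisos₁₃ F N ∧ Rg F θ ∧ θ.Admissible F N) →
        N16HolderMSAt (ne3OfRecord₁₁ F (ne3ConstLayerOfRecord₁₁ F N (ℓ₃ F))) β :=
  s_N16HolderMS_rRec₁₃On_iff_ofRecord β _ Rg ℓ₃ (readingOfRecord₁₃_ne3 w1 ℓ₃ ne2 ne1)

/-- **`S_N16HolderMS β` AT THE CANONICAL READING OF RECORD** IS «`N16HolderMSAt` at RR-1's object with letters `ℓ₃ F` for every family carrying a Stage-13 datum of record».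
[folklore] -/
theorem s_N16HolderMS_readingOfRecord₁₃_iff :
    S_N16HolderMS β (RRec₁₃ (readingOfRecord₁₃ w1 ℓ₃ ne2 ne1)) ↔
      ∀ (F : T4Family), (∃ D : Datum F N, IsDatumOfRecord₁₃C F N D) → N16HolderMSAt (ne3OfRecord₁₁ F (ne3ConstLayerOfRecord₁₁ F N (ℓ₃ F))) β :=
  s_N16HolderMS_rRec₁₃_iff_ofRecord β _ ℓ₃ (readingOfRecord₁₃_ne3 w1 ℓ₃ ne2 ne1)

/-- ★ **N21's MS-FACE AT THE REGIME-RESTRICTED READING OF RECORD** — `CovRootHolderMS` at RR-1's period, the reading's letters `ℓ₃ F` and the data of record, at every guarded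
family. [folklore] -/
theorem covRootHolderMS_readingOfRecord₁₃On (hS : S_N16HolderMS β (RRec₁₃On (readingOfRecord₁₃ w1 ℓ₃ ne2 ne1) Rg)) (F : T4Family) {θ : Stage13Params F N}
    (hP : θ.Provisos₁₃ F N) (hRg : Rg F θ) (hθ : θ.Admissible F N) :
    CovRootHolderMS 4 (sfClass 4 (ne3LOfRecord₁₁ F) (ne3NperOfRecord₁₁ F 0 0) (ℓ₃ F).ε) (ne3LOfRecord₁₁ F) (ne3NperOfRecord₁₁ F 0 0) (ℓ₃ F).b (ℓ₃ F).g (ℓ₃ F).C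
      (ℓ₃ F).Λ₁ (ℓ₃ F).Λ₂' β (ne3DomOfRecord₁₁ F N 0 0) :=
  covRootHolderMS_rRec₁₃On_ofRecord β _ Rg ℓ₃ (readingOfRecord₁₃_ne3 w1 ℓ₃ ne2 ne1) hS F hP hRg hθ

/-- **N21's MS-FACE AT THE CANONICAL READING OF RECORD** (one family carrying a Stage-13 datum of record). [folklore] -/
theorem covRootHolderMS_readingOfRecord₁₃ (hS : S_N16HolderMS β (RRec₁₃ (readingOfRecord₁₃ w1 ℓ₃ ne2 ne1))) (F : T4Family) {D : Datum F N}
    (hD : IsDatumOfRecord₁₃C F N D) :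
    CovRootHolderMS 4 (sfClass 4 (ne3LOfRecord₁₁ F) (ne3NperOfRecord₁₁ F 0 0) (ℓ₃ F).ε) (ne3LOfRecord₁₁ F) (ne3NperOfRecord₁₁ F 0 0) (ℓ₃ F).b (ℓ₃ F).g (ℓ₃ F).C
      (ℓ₃ F).Λ₁ (ℓ₃ F).Λ₂' β (ne3DomOfRecord₁₁ F N 0 0) :=
  covRootHolderMS_rRec₁₃_ofRecord β _ ℓ₃ (readingOfRecord₁₃_ne3 w1 ℓ₃ ne2 ne1) hS F hD

end NamedReading

/-! ## §5 Honesty (R422): the empty guard; the MS stub is refuted wherever the β-stub is -/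

/-- **HONESTY FACE: THE MS STUB AT THE REGIME-RESTRICTED HOME IS VACUOUS WHEN THE GUARD IS EMPTY** — if no family has an admissible Stage-13 tuple with provisos in `Rg`, then
`S_N16HolderMS β (RRec₁₃On 𝔯 Rg)` for EVERY reading and EVERY exponent, content-free.  The existence of a guarded admissible tuple (K0‴ ∕ RR-2's CN key) is where the stub
starts to bite. [folklore] -/
theorem s_N16HolderMS_rRec₁₃On_of_guard_empty (hempty : ∀ (F : T4Family) (θ : Stage13Params F N), θ.Provisos₁₃ F N → Rg F θ → ¬ θ.Admissible F N) :
    S_N16HolderMS β (RRec₁₃On 𝔯 Rg) :=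
  (s_N16HolderMS_rRec₁₃On_iff β 𝔯 Rg).2 fun F θ hP hRg hθ _ _ _ => absurd hθ (hempty F θ hP hRg)

/-- **THE MS STUB IS REFUTED WHEREVER THE β-STUB IS** (contrapositive of §1's side-condition-free weakening): every junk test of the β-currency at this home — e.g. a reading
pinning a negative Lipschitz letter at a guarded family (module 19 §7 at `β = 1`) — refutes `S_N16HolderMS β` as well. [folklore] -/
theorem not_s_N16HolderMS_rRec₁₃On_of_not_s_N16Holder (h : ¬ S_N16Holder β (RRec₁₃On 𝔯 Rg)) : ¬ S_N16HolderMS β (RRec₁₃On 𝔯 Rg) :=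
  fun hS => h (s_N16Holder_rRec₁₃On_of_s_N16HolderMS β 𝔯 Rg hS)

end

end Summit.QuantumFields.YangMills.BalabanUVNodes.N16HolderMSAtRecord13
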